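import Literature.AlgebraicGeometry.Resolution.GeneralizedStabilityTrdegOne
import Literature.AlgebraicGeometry.Resolution.CompositeValuations
import HarnessLib

/-!
# Generalized stability for `K(t)`: lemmas for the reduction to rank one (Kuhlmann 2010, Lemma 5.4)

Topic: `Literature/AlgebraicGeometry/Resolution` (valued function fields). Fully PROVED
valuation-theoretic lemmas behind Lemma 5.4 of F.-V. Kuhlmann, *Elimination of ramification I:
The generalized stability theorem*, Trans. AMS 362 (2010) 5697–5727 = arXiv:1003.5678 ("(R3) ⇐
(R4)": decompose a valuation of finite rank on `F = K(t)` into rank-one pieces, `v = w∘w̄`), for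
a valued rational function field `F = K(t)` whose generator `t` is value-transcendental over
`K` (`n·vt ∉ vK` for `n ≥ 1`), in the rendering of `GeneralizedStabilityTrdegOne.lean` and
`CompositeValuations.lean` (coarsenings = overrings `O ≤ O₁`, `w̄ ↦ residueValuationSubring`).
They are assembled in `GeneralizedStabilityFiniteRankProofs.lean`.

## Content

* `exists_valuation_sum_eq` — the strict triangle inequality for finite sums with pairwise
  distinct values; `valuation_le_of_le`, `mem_of_valuation_le_of_mem` — coarsenings are monotone
  on values; `exists_max_proper_overring` — a valuation ring `≠ F` of finite rank has a rank-one
  coarsening (largest proper overring).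
* `not_lt_lt_of_comap_eq`, `finite_overrings_of_valueTranscendental` — **`K(t)` has finite rank
  with `K`**: no three overrings of `K(t)°` restrict to the same ring of `K` (Lemma 2.5:
  `vK(t) = vK ⊕ ℤvt`, so `rr vK(t)/vK = 1`; cf. the source, proof of Lemma 5.4: "the rank of
  `vF` cannot exceed the rank of `vK` plus `rr vL/vK`"); `rankOne_of_comap_eq_top` — over a
  trivially valued `K`, `K(t)` has rank one.
* `valueTranscendental_or_residueTranscendental` — **Lemma 2.8 for `K(t)`**: under a coarsening
  `w` of `v`, either `t` stays value-transcendental, or (for `K` algebraically closed) some `t/d`,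
  `d ∈ K^×`, has `w`-value `0` and `w`-residue transcendental over `Kw`
  (`transcendental_residue_of_valuation_eq_one`: a relation `∑ c̄ᵢ t̄ⁱ = 0` over `Kw` lifts to
  `w(∑ cᵢ tⁱ) > 0`, contradicting the `v`-dominant monomial).
* `closure_residueSubfield_union_eq_top` — Lemma 2.5 for the Gauss valuation: `K(t₁)w = Kw(t̄₁)`;
  `valueTranscendental_residue` — `t̄₁` is value-transcendental for `w̄` over `Kw`;
  `comap_residueFieldHom_residueValuationSubring` — `w̄` restricts on `Kw` to the residue
  valuation of `K° ⊆ K_w°`; `isAlgClosed_residueField_of_isAlgClosed` (Lemma 2.1) and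
  `isDefectlessField_of_isAlgClosed` — an algebraically closed valued field has algebraically
  closed residue field and is (trivially) a defectless field.

## Source

* F.-V. Kuhlmann, loc. cit.: §2.1 (Lemma 2.1, Lemma 2.5, composite valuations, rank; Lemma 2.8),
  §5, proof of Lemma 5.4 (p. 18 of arXiv:1003.5678).
-/

noncomputable section

open IsLocalRing

namespace Literature.AlgebraicGeometry.Resolution

universe u

/-! ### General lemmas on valuation rings and coarsenings -/

section Helpers

variable {F : Type u} [Field F]

/-- Membership in an overring `S ⊇ O` only depends on the `O`-value: if `v(a) ≤ v(b)` and
`b ∈ S` then `a ∈ S`. [folklore] -/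
theorem mem_of_valuation_le_of_mem (O S : ValuationSubring F) (hS : O ≤ S) {a b : F}
    (hab : O.valuation a ≤ O.valuation b) (hb : b ∈ S) : a ∈ S := by
  by_cases hb0 : b = 0
  · rw [hb0, map_zero, le_zero_iff, map_eq_zero] at hab
    rw [hab]
    exact zero_mem S
  · have hq : a / b ∈ O := by
      rw [← O.valuation_le_one_iff, map_div₀]
      exact div_le_one_of_le₀ hab zero_le
    have : a = a / b * b := by field_simp
    rw [this]
    exact mul_mem (hS hq) hb

/-- A coarsening `O₁ ⊇ O` is monotone on values: `v(a) ≤ v(b) ⇒ w(a) ≤ w(b)`. [folklore] -/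
theorem valuation_le_of_le (O O₁ : ValuationSubring F) (h : O ≤ O₁) {a b : F}
    (hab : O.valuation a ≤ O.valuation b) : O₁.valuation a ≤ O₁.valuation b := by
  by_cases hb0 : b = 0
  · rw [hb0, map_zero, le_zero_iff, map_eq_zero] at hab
    rw [hab, hb0]
  · have hq : a / b ∈ O₁ := by
      refine h ?_
      rw [← O.valuation_le_one_iff, map_div₀]
      exact div_le_one_of_le₀ hab zero_le
    rw [← O₁.valuation_le_one_iff, map_div₀] at hq
    have hb' : O₁.valuation b ≠ 0 := (map_ne_zero _).mpr hb0
    rwa [div_le_one₀ (zero_lt_iff.mpr hb')] at hq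

/-- A coarsening preserves equality of values: `v(a) = v(b) ⇒ w(a) = w(b)`. [folklore] -/
theorem valuation_eq_of_le (O O₁ : ValuationSubring F) (h : O ≤ O₁) {a b : F}
    (hab : O.valuation a = O.valuation b) : O₁.valuation a = O₁.valuation b :=
  le_antisymm (valuation_le_of_le O O₁ h hab.le) (valuation_le_of_le O O₁ h hab.ge)

/-- Value groups are torsion free: `v(a)^n = v(b)^n` with `n ≠ 0` forces `v(a) = v(b)`.
[folklore] -/
theorem valuation_eq_of_pow_eq (O : ValuationSubring F) {a b : F} {n : ℕ} (hn : n ≠ 0)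
    (h : O.valuation a ^ n = O.valuation b ^ n) : O.valuation a = O.valuation b := by
  by_cases hb0 : b = 0
  · rw [hb0, map_zero, zero_pow hn, pow_eq_zero_iff hn, map_eq_zero] at h
    rw [h, hb0]
  by_cases ha0 : a = 0
  · rw [ha0, map_zero, zero_pow hn, eq_comm, pow_eq_zero_iff hn, map_eq_zero] at h
    exact absurd h hb0
  have h1 : (a / b) ^ n ∈ O := by
    rw [← O.valuation_le_one_iff, map_pow, map_div₀, div_pow, h, div_self]
    exact pow_ne_zero _ ((map_ne_zero _).mpr hb0)
  have h2 : (b / a) ^ n ∈ O := by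
    rw [← O.valuation_le_one_iff, map_pow, map_div₀, div_pow, h, div_self]
    exact pow_ne_zero _ ((map_ne_zero _).mpr hb0)
  have h1' := mem_of_pow_mem hn h1
  have h2' := mem_of_pow_mem hn h2
  rw [← O.valuation_le_one_iff, map_div₀] at h1' h2'
  have ha' : 0 < O.valuation a := zero_lt_iff.mpr ((map_ne_zero _).mpr ha0)
  have hb' : 0 < O.valuation b := zero_lt_iff.mpr ((map_ne_zero _).mpr hb0)
  rw [div_le_one₀ hb'] at h1'
  rw [div_le_one₀ ha'] at h2'
  exact le_antisymm h1' h2'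

/-- **The value of a sum of terms with pairwise distinct values is the largest of them** (the
strict triangle inequality): there is an index `i₀` carrying the value of the sum and dominating
all terms. [folklore] -/
theorem exists_valuation_sum_eq (O : ValuationSubring F) {ι : Type*} (s : Finset ι) (hs : s.Nonempty)
    (a : ι → F) (hinj : Set.InjOn (fun i => O.valuation (a i)) s) :
    ∃ i₀ ∈ s, O.valuation (∑ i ∈ s, a i) = O.valuation (a i₀) ∧
      ∀ i ∈ s, O.valuation (a i) ≤ O.valuation (a i₀) := by
  classical
  obtain ⟨i₀, hi₀, hmax⟩ := s.exists_max_image (fun i => O.valuation (a i)) hs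
  refine ⟨i₀, hi₀, ?_, hmax⟩
  rw [← Finset.add_sum_erase s a hi₀]
  by_cases h0 : O.valuation (a i₀) = 0
  · -- all values are `≤ 0`, hence everything vanishes
    have hall : ∀ i ∈ s, a i = 0 := fun i hi => by
      have := hmax i hi
      rw [h0, le_zero_iff, map_eq_zero] at this
      exact this
    rw [(map_eq_zero O.valuation).mp h0, zero_add, Finset.sum_eq_zero fun i hi => hall i
      (Finset.mem_of_mem_erase hi), map_zero]
  · refine O.valuation.map_add_eq_of_lt_left (O.valuation.map_sum_lt h0 fun i hi => ?_)
    have hi' := Finset.mem_of_mem_erase hi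
    refine lt_of_le_of_ne (hmax i hi') fun heq => ?_
    exact (Finset.ne_of_mem_erase hi) (hinj hi' hi₀ heq)

/-- Integer powers of an element `x` with `x, x⁻¹ ∈ S` lie in `S`. [folklore] -/
theorem zpow_mem_of_mem_of_inv_mem (S : ValuationSubring F) {x : F} (hx : x ∈ S) (hxi : x⁻¹ ∈ S)
    (m : ℤ) : x ^ m ∈ S := by
  rcases Int.eq_nat_or_neg m with ⟨n, rfl | rfl⟩
  · rw [zpow_natCast]
    exact pow_mem hx n
  · rw [zpow_neg, zpow_natCast, ← inv_pow]
    exact pow_mem hxi n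

/-- If `x^m` and `x^{-m}` lie in the valuation ring `S` for some integer `m ≠ 0`, then `x ∈ S`.
[folklore] -/
theorem mem_of_zpow_mem (S : ValuationSubring F) {x : F} {m : ℤ} (hm : m ≠ 0) (h1 : x ^ m ∈ S)
    (h2 : x ^ (-m) ∈ S) : x ∈ S := by
  rcases Int.eq_nat_or_neg m with ⟨n, rfl | rfl⟩
  · have hn : n ≠ 0 := by rintro rfl; exact hm (by simp)
    rw [zpow_natCast] at h1
    exact mem_of_pow_mem hn h1
  · have hn : n ≠ 0 := by rintro rfl; exact hm (by simp)
    rw [neg_neg, zpow_natCast] at h2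
    exact mem_of_pow_mem hn h2

end Helpers

/-! ### Finite rank: largest proper overring -/

section MaxOverring

variable {F : Type u} [Field F]

/-- A valuation ring `O ≠ F` of finite rank has a largest proper overring `O₁`, whose only
overrings are `O₁` and `F` (the rank-one coarsening). [folklore] -/
theorem exists_max_proper_overring (O : ValuationSubring F) [Finite {S : ValuationSubring F // O ≤ S}]
    (hO : O ≠ ⊤) :
    ∃ O₁ : ValuationSubring F, O ≤ O₁ ∧ O₁ ≠ ⊤ ∧
      ∀ S : ValuationSubring F, O₁ ≤ S → S = O₁ ∨ S = ⊤ := by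
  let A := {S : {S : ValuationSubring F // O ≤ S} // S.1 ≠ ⊤}
  haveI : Nonempty A := ⟨⟨⟨O, le_rfl⟩, hO⟩⟩
  obtain ⟨a₀, ha₀⟩ := Finite.exists_max fun a : A => (a : {S : ValuationSubring F // O ≤ S})
  refine ⟨a₀.1.1, a₀.1.2, a₀.2, fun S hS => ?_⟩
  by_cases hST : S = ⊤
  · exact Or.inr hST
  · left
    have hle : S ≤ a₀.1.1 := by
      have := ha₀ ⟨⟨S, le_trans a₀.1.2 hS⟩, hST⟩
      exact this
    exact le_antisymm hle hS

end MaxOverring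

/-! ### `F = K(t)` with `t` value-transcendental: overrings -/

section Overrings

variable {K F : Type u} [Field K] [Field F] [Algebra K F] (O : ValuationSubring F) {t : F}
  (hvt : ∀ n : ℕ, 0 < n → ∀ c : K, O.valuation t ^ n ≠ O.valuation (algebraMap K F c))
  (hgen : IntermediateField.adjoin K ({t} : Set F) = ⊤)

include hvt

/-- `O ≠ F`: the value of `t` is not `1 = v(1)`. [folklore] -/
theorem ne_top_of_valueTranscendental : O ≠ ⊤ := by
  intro hO
  have ht0 : t ≠ 0 := ne_zero_of_valueTranscendental O hvt
  apply hvt 1 one_pos 1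
  rw [pow_one, map_one, map_one]
  have h1 : t ∈ O := by rw [hO]; exact ValuationSubring.mem_top t
  have h2 : t⁻¹ ∈ O := by rw [hO]; exact ValuationSubring.mem_top _
  rw [← O.valuation_le_one_iff] at h1 h2
  rw [map_inv₀] at h2
  exact le_antisymm h1 ((inv_le_one₀ (zero_lt_iff.mpr ((map_ne_zero _).mpr ht0))).mp h2)

omit hvt in
/-- Membership of an element of `K` in an overring is read off in `K`. [folklore] -/
theorem algebraMap_mem_iff_of_comap_eq {S S' : ValuationSubring F}
    (he : S.comap (algebraMap K F) = S'.comap (algebraMap K F)) (c : K) :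
    algebraMap K F c ∈ S ↔ algebraMap K F c ∈ S' := by
  change c ∈ S.comap (algebraMap K F) ↔ c ∈ S'.comap (algebraMap K F)
  rw [he]

include hgen

/-- **No three overrings of `K(t)°` restrict to the same valuation ring of `K`** (`t`
value-transcendental): the rank of `K(t)` is at most twice the rank of `K` (a special case of
"rank `vF ≤` rank `vK + rr(vF/vK)`", cf. Kuhlmann 2010, proof of Lemma 5.4). [folklore] -/
theorem not_lt_lt_of_comap_eq {S₁ S₂ S₃ : ValuationSubring F} (h₁ : O ≤ S₁) (h₁₂ : S₁ < S₂)
    (h₂₃ : S₂ < S₃) (he₁₂ : S₁.comap (algebraMap K F) = S₂.comap (algebraMap K F))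
    (he₂₃ : S₂.comap (algebraMap K F) = S₃.comap (algebraMap K F)) : False := by
  obtain ⟨h₁₂le, x, hx₂, hx₁⟩ := SetLike.lt_iff_le_and_exists.mp h₁₂
  obtain ⟨h₂₃le, y, hy₃, hy₂⟩ := SetLike.lt_iff_le_and_exists.mp h₂₃
  have hx0 : x ≠ 0 := fun h => hx₁ (h ▸ zero_mem _)
  have hy0 : y ≠ 0 := fun h => hy₂ (h ▸ zero_mem _)
  have ht0 : t ≠ 0 := ne_zero_of_valueTranscendental O hvt
  have hvt0 : O.valuation t ≠ 0 := (map_ne_zero _).mpr ht0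
  obtain ⟨m, c, hxv⟩ := exists_valuation_eq_of_valueTranscendental O hvt hgen hx0
  obtain ⟨n, d, hyv⟩ := exists_valuation_eq_of_valueTranscendental O hvt hgen hy0
  -- `m ≠ 0`: otherwise `v(x) = v(c)` and `x ∈ S₂ ⇒ c ∈ S₂ ∩ K = S₁ ∩ K ⇒ x ∈ S₁`
  have hm : m ≠ 0 := by
    intro hm
    rw [hm, zpow_zero, mul_one] at hxv
    have hc₂ : algebraMap K F c ∈ S₂ :=
      mem_of_valuation_le_of_mem O S₂ (h₁.trans h₁₂le) hxv.ge hx₂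
    have hc₁ : algebraMap K F c ∈ S₁ := (algebraMap_mem_iff_of_comap_eq he₁₂ c).mpr hc₂
    exact hx₁ (mem_of_valuation_le_of_mem O S₁ h₁ hxv.le hc₁)
  have hn : n ≠ 0 := by
    intro hn
    rw [hn, zpow_zero, mul_one] at hyv
    have hd₃ : algebraMap K F d ∈ S₃ :=
      mem_of_valuation_le_of_mem O S₃ ((h₁.trans h₁₂le).trans h₂₃le) hyv.ge hy₃
    have hd₂ : algebraMap K F d ∈ S₂ := (algebraMap_mem_iff_of_comap_eq he₂₃ d).mpr hd₃
    exact hy₂ (mem_of_valuation_le_of_mem O S₂ (h₁.trans h₁₂le) hyv.le hd₂)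
  -- `x` is a unit of `S₂`, `y` a unit of `S₃`
  have hxi₂ : x⁻¹ ∈ S₂ := h₁₂le ((S₁.mem_or_inv_mem x).resolve_left hx₁)
  have hyi₃ : y⁻¹ ∈ S₃ := h₂₃le ((S₂.mem_or_inv_mem y).resolve_left hy₂)
  have hxz₂ : ∀ k : ℤ, x ^ k ∈ S₂ := zpow_mem_of_mem_of_inv_mem S₂ hx₂ hxi₂
  have hyz₃ : ∀ k : ℤ, y ^ k ∈ S₃ := zpow_mem_of_mem_of_inv_mem S₃ hy₃ hyi₃
  -- `q = y^m / x^n` has the value of `e = d^m / c^n ∈ K`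
  have hev : O.valuation (y ^ m / x ^ n) = O.valuation (algebraMap K F (d ^ m / c ^ n)) := by
    simp only [map_div₀, map_zpow₀]
    rw [hxv, hyv, mul_zpow, mul_zpow, ← zpow_mul, ← zpow_mul, mul_comm n m,
      mul_div_mul_right _ _ (zpow_ne_zero _ hvt0)]
  have hevi : O.valuation (y ^ m / x ^ n)⁻¹ = O.valuation (algebraMap K F (d ^ m / c ^ n))⁻¹ := by
    rw [map_inv₀, map_inv₀, hev]
  -- `q, q⁻¹ ∈ S₃`, hence `e, e⁻¹ ∈ S₃ ∩ K = S₂ ∩ K`, hence `q, q⁻¹ ∈ S₂`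
  have hq₃ : y ^ m / x ^ n ∈ S₃ := by
    rw [div_eq_mul_inv, ← zpow_neg]
    exact mul_mem (hyz₃ m) (h₂₃le (hxz₂ (-n)))
  have hqi₃ : (y ^ m / x ^ n)⁻¹ ∈ S₃ := by
    rw [inv_div, div_eq_mul_inv, ← zpow_neg]
    exact mul_mem (h₂₃le (hxz₂ n)) (hyz₃ (-m))
  have hO₃ : O ≤ S₃ := (h₁.trans h₁₂le).trans h₂₃le
  have he₃ : algebraMap K F (d ^ m / c ^ n) ∈ S₃ := mem_of_valuation_le_of_mem O S₃ hO₃ hev.ge hq₃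
  have hei₃ : (algebraMap K F (d ^ m / c ^ n))⁻¹ ∈ S₃ :=
    mem_of_valuation_le_of_mem O S₃ hO₃ hevi.ge hqi₃
  have he₂ : algebraMap K F (d ^ m / c ^ n) ∈ S₂ := (algebraMap_mem_iff_of_comap_eq he₂₃ _).mpr he₃
  have hei₂ : (algebraMap K F (d ^ m / c ^ n))⁻¹ ∈ S₂ := by
    rw [← map_inv₀] at hei₃ ⊢
    exact (algebraMap_mem_iff_of_comap_eq he₂₃ _).mpr hei₃
  have hq₂ : y ^ m / x ^ n ∈ S₂ := mem_of_valuation_le_of_mem O S₂ (h₁.trans h₁₂le) hev.le he₂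
  have hqi₂ : (y ^ m / x ^ n)⁻¹ ∈ S₂ :=
    mem_of_valuation_le_of_mem O S₂ (h₁.trans h₁₂le) hevi.le hei₂
  -- so `y^m, y^{-m} ∈ S₂`, i.e. `y ∈ S₂`: contradiction
  have hxn0 : x ^ n ≠ 0 := zpow_ne_zero n hx0
  have h1 : y ^ m ∈ S₂ := by
    have : y ^ m = y ^ m / x ^ n * x ^ n := (div_mul_cancel₀ _ hxn0).symm
    rw [this]
    exact mul_mem hq₂ (hxz₂ n)
  have h2 : y ^ (-m) ∈ S₂ := by
    have : y ^ (-m) = (y ^ m / x ^ n)⁻¹ * x ^ (-n) := by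
      rw [inv_div, zpow_neg x, div_mul_eq_mul_div, mul_inv_cancel₀ hxn0, one_div, zpow_neg]
    rw [this]
    exact mul_mem hqi₂ (hxz₂ (-n))
  exact hy₂ (mem_of_zpow_mem S₂ hm h1 h2)

/-- **`K(t)` has finite rank if `K` has** (`t` value-transcendental): the overrings of `K(t)°`
are finitely many, at most two above each overring of `K°`. [folklore] -/
theorem finite_overrings_of_valueTranscendental
    [Finite {S : ValuationSubring K // O.comap (algebraMap K F) ≤ S}] :
    Finite {S : ValuationSubring F // O ≤ S} := by
  classical
  let f : {S : ValuationSubring F // O ≤ S} →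
      {T : ValuationSubring K // O.comap (algebraMap K F) ≤ T} × Bool := fun S =>
    (⟨S.1.comap (algebraMap K F), fun c hc => S.2 hc⟩,
      decide (∃ S' : {S : ValuationSubring F // O ≤ S},
        S' < S ∧ S'.1.comap (algebraMap K F) = S.1.comap (algebraMap K F)))
  refine Finite.of_injective f fun S S' h => ?_
  simp only [f, Prod.mk.injEq, Subtype.mk.injEq, decide_eq_decide] at h
  obtain ⟨hc, hflag⟩ := h
  by_contra hne
  rcases lt_or_gt_of_ne hne with hlt | hlt
  · obtain ⟨S₀, hS₀, hc₀⟩ := hflag.mpr ⟨S, hlt, hc⟩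
    exact not_lt_lt_of_comap_eq O hvt hgen S₀.2 hS₀ hlt hc₀ hc
  · obtain ⟨S₀, hS₀, hc₀⟩ := hflag.mp ⟨S', hlt, hc.symm⟩
    exact not_lt_lt_of_comap_eq O hvt hgen S₀.2 hS₀ hlt hc₀ hc.symm

/-- **Over a trivially valued `K`, `K(t)` has rank one** (`t` value-transcendental): the only
overrings of `K(t)°` are `K(t)°` and `K(t)` (the value group is `ℤ·vt`). [folklore] -/
theorem rankOne_of_comap_eq_top (hK : O.comap (algebraMap K F) = ⊤) :
    O ≠ ⊤ ∧ ∀ S : ValuationSubring F, O ≤ S → S = O ∨ S = ⊤ := by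
  refine ⟨ne_top_of_valueTranscendental O hvt, fun S hS => ?_⟩
  by_cases hSO : S = O
  · exact Or.inl hSO
  right
  obtain ⟨x, hxS, hxO⟩ : ∃ x ∈ S, x ∉ O := by
    by_contra h
    push Not at h
    exact hSO (le_antisymm (fun x hx => h x hx) hS)
  have hx0 : x ≠ 0 := fun h => hxO (h ▸ zero_mem _)
  have ht0 : t ≠ 0 := ne_zero_of_valueTranscendental O hvt
  -- `K` is trivially valued
  have hKO : ∀ c : K, algebraMap K F c ∈ O := fun c => by
    change c ∈ O.comap (algebraMap K F)
    rw [hK]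
    exact ValuationSubring.mem_top c
  have hKv : ∀ c : K, c ≠ 0 → O.valuation (algebraMap K F c) = 1 := fun c hc => by
    have h1 := (O.valuation_le_one_iff _).mpr (hKO c)
    have h2 := (O.valuation_le_one_iff _).mpr (hKO c⁻¹)
    rw [map_inv₀, map_inv₀] at h2
    exact le_antisymm h1 ((inv_le_one₀ (zero_lt_iff.mpr ((map_ne_zero _).mpr
      ((map_ne_zero (algebraMap K F)).mpr hc)))).mp h2)
  -- `v(x) = v(t)^m` with `m ≠ 0`
  obtain ⟨m, c, hxv⟩ := exists_valuation_eq_of_valueTranscendental O hvt hgen hx0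
  have hc0 : c ≠ 0 := by
    rintro rfl
    rw [map_zero, map_zero, zero_mul, map_eq_zero] at hxv
    exact hx0 hxv
  rw [hKv c hc0, one_mul] at hxv
  have hm : m ≠ 0 := by
    rintro rfl
    rw [zpow_zero] at hxv
    exact hxO ((O.valuation_le_one_iff x).mp hxv.le)
  -- `t^m, t^{-m} ∈ S`, so `t, t⁻¹ ∈ S`
  have h1 : t ^ m ∈ S := mem_of_valuation_le_of_mem O S hS (by rw [map_zpow₀, hxv]) hxS
  have h2 : t ^ (-m) ∈ S := by
    refine hS ((O.valuation_le_one_iff _).mp ?_)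
    rw [map_zpow₀, zpow_neg, ← hxv]
    have hvx : 1 < O.valuation x := by
      rw [← not_le, O.valuation_le_one_iff]
      exact hxO
    exact inv_le_one_of_one_le₀ hvx.le
  have htS : t ∈ S := mem_of_zpow_mem S hm h1 h2
  have htiS : t⁻¹ ∈ S := by
    refine mem_of_zpow_mem S hm ?_ ?_
    · rw [inv_zpow']
      exact h2
    · rw [inv_zpow', neg_neg]
      exact h1
  -- every element of `F` has the value of a power of `t`
  refine eq_top_iff.mpr fun y _ => ?_
  by_cases hy0 : y = 0
  · rw [hy0]
    exact zero_mem S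
  obtain ⟨k, c', hyv⟩ := exists_valuation_eq_of_valueTranscendental O hvt hgen hy0
  have hc'0 : c' ≠ 0 := by
    rintro rfl
    rw [map_zero, map_zero, zero_mul, map_eq_zero] at hyv
    exact hy0 hyv
  rw [hKv c' hc'0, one_mul, ← map_zpow₀] at hyv
  exact mem_of_valuation_le_of_mem O S hS hyv.le (zpow_mem_of_mem_of_inv_mem S htS htiS k)

end Overrings

/-! ### The generator under the rank-one coarsening: value- or residue-transcendental -/

section Dichotomy

variable {K F : Type u} [Field K] [Field F] [Algebra K F] (O O₁ : ValuationSubring F) (hle : O ≤ O₁)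
  {t : F} (hvt : ∀ n : ℕ, 0 < n → ∀ c : K, O.valuation t ^ n ≠ O.valuation (algebraMap K F c))

include hvt in
/-- `t / d`, `d ∈ K^×`, is value-transcendental with `t`. [folklore] -/
theorem valueTranscendental_div {d : K} (hd : d ≠ 0) :
    ∀ n : ℕ, 0 < n → ∀ c : K,
      O.valuation (t / algebraMap K F d) ^ n ≠ O.valuation (algebraMap K F c) := by
  intro n hn c h
  apply hvt n hn (c * d ^ n)
  have hd' : O.valuation (algebraMap K F d) ^ n ≠ 0 :=
    pow_ne_zero _ ((map_ne_zero _).mpr ((map_ne_zero _).mpr hd))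
  rw [map_mul, map_pow, map_mul, map_pow, ← h, map_div₀, div_pow, div_mul_cancel₀ _ hd']

omit hle in
/-- `K(t) = K(t/d)` for `d ∈ K^×`. [folklore] -/
theorem adjoin_div_eq_top (hgen : IntermediateField.adjoin K ({t} : Set F) = ⊤) {d : K} (hd : d ≠ 0) :
    IntermediateField.adjoin K ({t / algebraMap K F d} : Set F) = ⊤ := by
  have hd' : algebraMap K F d ≠ 0 := (map_ne_zero _).mpr hd
  have hmem : t ∈ IntermediateField.adjoin K ({t / algebraMap K F d} : Set F) := by
    have h1 : t / algebraMap K F d ∈ IntermediateField.adjoin K ({t / algebraMap K F d} : Set F) :=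
      IntermediateField.subset_adjoin _ _ rfl
    have h2 := mul_mem h1 (algebraMap_mem (IntermediateField.adjoin K ({t / algebraMap K F d} : Set F)) d)
    rwa [div_mul_cancel₀ _ hd'] at h2
  rw [eq_top_iff, ← hgen, IntermediateField.adjoin_le_iff, Set.singleton_subset_iff]
  exact hmem

/-- The residue of `a / s` for `s` of value `1`. [folklore] -/
theorem residue_mk_div (O₁ : ValuationSubring F) {a s : F} (ha : a ∈ O₁) (hs : s ∈ O₁)
    (hs1 : O₁.valuation s = 1) (has : a / s ∈ O₁) :
    residue O₁ ⟨a / s, has⟩ = residue O₁ ⟨a, ha⟩ / residue O₁ ⟨s, hs⟩ := by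
  have hunit : IsUnit (⟨s, hs⟩ : O₁) := (O₁.valuation_eq_one_iff _).mpr hs1
  have hne : residue O₁ ⟨s, hs⟩ ≠ 0 := fun h =>
    ((IsLocalRing.mem_maximalIdeal _).mp ((residue_eq_zero_iff _).mp h)) hunit
  have hs0 : s ≠ 0 := fun h => by
    rw [h, map_zero] at hs1
    exact zero_ne_one hs1
  rw [eq_div_iff hne, ← map_mul]
  congr 1
  exact Subtype.ext (div_mul_cancel₀ a hs0)

include hle in
/-- **A generator of value `0` under the coarsening `w` is residue-transcendental for `w`**:
if `t₁ ∈ K(t)` is value-transcendental for `v = w ∘ w̄` over `K` and `w(t₁) = 0`, then the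
`w`-residue of `t₁` is transcendental over `Kw` (a polynomial relation `∑ c̄ᵢ t̄₁ⁱ = 0` lifts to
`w(∑ cᵢ t₁ⁱ) > 0`, while the `v`-dominant monomial `c_{i₀} t₁^{i₀}` has `w`-value `0`).
[cite: Kuhlmann2010, Lemma 2.8 and Section 5, proof of Lemma 5.4] -/
theorem transcendental_residue_of_valuation_eq_one {t₁ : F} (ht₁ : t₁ ∈ O₁)
    (hw : O₁.valuation t₁ = 1)
    (hvt₁ : ∀ n : ℕ, 0 < n → ∀ c : K, O.valuation t₁ ^ n ≠ O.valuation (algebraMap K F c)) :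
    Transcendental (residueSubfield K O₁) (residue O₁ ⟨t₁, ht₁⟩) := by
  classical
  rintro ⟨p, hp0, hp⟩
  have ht₁0 : t₁ ≠ 0 := fun h => by
    rw [h, map_zero] at hw
    exact zero_ne_one hw
  -- lift the coefficients of `p` to `K ∩ O₁`
  have hcoef : ∀ i, ∃ (c : K) (h : algebraMap K F c ∈ O₁),
      residue O₁ ⟨algebraMap K F c, h⟩ = (p.coeff i : ResidueField O₁) := fun i =>
    (mem_residueSubfield_iff K O₁ _).mp (p.coeff i).2
  choose c hc hcr using hcoef
  let a : ℕ → F := fun i => algebraMap K F (c i) * t₁ ^ i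
  have ha : ∀ i, a i ∈ O₁ := fun i => mul_mem (hc i) (pow_mem ht₁ i)
  have hres : ∀ i, residue O₁ ⟨a i, ha i⟩ =
      (p.coeff i : ResidueField O₁) * residue O₁ ⟨t₁, ht₁⟩ ^ i := fun i => by
    rw [← hcr i, ← map_pow, ← map_mul]
    rfl
  have hsum_mem : (∑ i ∈ p.support, a i) ∈ O₁ := sum_mem fun i _ => ha i
  -- its residue is `p(t̄₁) = 0`, so `w(∑ cᵢ t₁ⁱ) > 0`
  have hsum_res : residue O₁ ⟨∑ i ∈ p.support, a i, hsum_mem⟩ = 0 := by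
    have hcoe : (⟨∑ i ∈ p.support, a i, hsum_mem⟩ : O₁) = ∑ i ∈ p.support, ⟨a i, ha i⟩ :=
      Subtype.ext (by push_cast; rfl)
    rw [hcoe, map_sum]
    simp_rw [hres]
    rw [← hp, Polynomial.aeval_def, Polynomial.eval₂_eq_sum, Polynomial.sum_def]
    rfl
  have hws : O₁.valuation (∑ i ∈ p.support, a i) < 1 :=
    (O₁.valuation_lt_one_iff ⟨_, hsum_mem⟩).mp ((residue_eq_zero_iff _).mp hsum_res)
  -- the coefficients `cᵢ`, `i ∈ supp p`, are `w`-units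
  have hcw : ∀ i ∈ p.support, O₁.valuation (algebraMap K F (c i)) = 1 := fun i hi => by
    have hne : residue O₁ ⟨algebraMap K F (c i), hc i⟩ ≠ 0 := by
      rw [hcr i]
      exact_mod_cast Polynomial.mem_support_iff.mp hi
    have hunit : IsUnit (⟨algebraMap K F (c i), hc i⟩ : O₁) := by
      by_contra hnu
      exact hne ((residue_eq_zero_iff _).mpr ((IsLocalRing.mem_maximalIdeal _).mpr hnu))
    exact (O₁.valuation_eq_one_iff _).mp hunit
  have hc0 : ∀ i ∈ p.support, c i ≠ 0 := fun i hi h => by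
    have := hcw i hi
    rw [h, map_zero, map_zero] at this
    exact zero_ne_one this
  -- the `v`-values of the monomials are pairwise distinct (`t₁` value-transcendental for `v`)
  have hinj : Set.InjOn (fun i => O.valuation (a i)) p.support := by
    intro i hi j hj hij
    simp only [a, map_mul, map_pow] at hij
    by_contra hne
    have key : ∀ i ∈ p.support, ∀ j ∈ p.support, i < j →
        O.valuation (algebraMap K F (c i)) * O.valuation t₁ ^ i ≠
          O.valuation (algebraMap K F (c j)) * O.valuation t₁ ^ j := by
      intro i hi j hj hlt hij
      apply hvt₁ (j - i) (Nat.sub_pos_of_lt hlt) (c i / c j)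
      have hcj : O.valuation (algebraMap K F (c j)) ≠ 0 :=
        (map_ne_zero _).mpr ((map_ne_zero _).mpr (hc0 j hj))
      have hti : O.valuation t₁ ^ i ≠ 0 := pow_ne_zero _ ((map_ne_zero _).mpr ht₁0)
      have hsplit : O.valuation t₁ ^ j = O.valuation t₁ ^ (j - i) * O.valuation t₁ ^ i := by
        rw [← pow_add, Nat.sub_add_cancel hlt.le]
      rw [hsplit, ← mul_assoc] at hij
      have h' := mul_right_cancel₀ hti hij
      rw [map_div₀, map_div₀, eq_div_iff hcj, h', mul_comm]
    rcases lt_or_gt_of_ne hne with hlt | hlt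
    · exact key i hi j hj hlt hij
    · exact key j hj i hi hlt hij.symm
  -- the `v`-dominant monomial has `w`-value `0`: contradiction
  obtain ⟨i₀, hi₀, hvs, -⟩ :=
    exists_valuation_sum_eq O p.support (Polynomial.support_nonempty.mpr hp0) a hinj
  have hws' : O₁.valuation (∑ i ∈ p.support, a i) = 1 := by
    rw [valuation_eq_of_le O O₁ hle hvs]
    simp only [a, map_mul, map_pow, hcw i₀ hi₀, hw, one_pow, mul_one]
  rw [hws'] at hws
  exact lt_irrefl _ hws

include hle hvt in
/-- **Dichotomy for the generator under a coarsening** (Kuhlmann 2010, proof of Lemma 5.4 via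
Lemma 2.8: "`(F|K,w₁)` … are valued function fields without transcendence defect"), for
`F = K(t)` with `t` value-transcendental for `v` over the algebraically closed `K` and a
coarsening `w` of `v`: either `t` is value-transcendental for `w`, or `t/d` (`d ∈ K^×`) has
`w`-value `0` and a `w`-residue transcendental over `Kw`. [cite: Kuhlmann2010, Lemma 2.8] -/
theorem valueTranscendental_or_residueTranscendental [IsAlgClosed K] :
    (∀ n : ℕ, 0 < n → ∀ c : K, O₁.valuation t ^ n ≠ O₁.valuation (algebraMap K F c)) ∨
    ∃ d : K, d ≠ 0 ∧ ∃ ht : t / algebraMap K F d ∈ O₁, O₁.valuation (t / algebraMap K F d) = 1 ∧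
      Transcendental (residueSubfield K O₁) (residue O₁ ⟨t / algebraMap K F d, ht⟩) := by
  by_cases hex : ∃ d : K, O₁.valuation t = O₁.valuation (algebraMap K F d)
  · right
    obtain ⟨d, hd⟩ := hex
    have ht0 : t ≠ 0 := ne_zero_of_valueTranscendental O hvt
    have hd0 : d ≠ 0 := by
      rintro rfl
      rw [map_zero, map_zero, map_eq_zero] at hd
      exact ht0 hd
    have hd0' : O₁.valuation (algebraMap K F d) ≠ 0 := (map_ne_zero _).mpr ((map_ne_zero _).mpr hd0)
    have hw : O₁.valuation (t / algebraMap K F d) = 1 := by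
      rw [map_div₀, hd, div_self hd0']
    have ht : t / algebraMap K F d ∈ O₁ := (O₁.valuation_le_one_iff _).mp hw.le
    exact ⟨d, hd0, ht, hw, transcendental_residue_of_valuation_eq_one O O₁ hle ht hw
      (valueTranscendental_div O hvt hd0)⟩
  · left
    push Not at hex
    intro n hn c h
    obtain ⟨d, rfl⟩ := IsAlgClosed.exists_pow_nat_eq c hn
    rw [map_pow, map_pow] at h
    exact hex d (valuation_eq_of_pow_eq O₁ hn.ne' h)

end Dichotomy

/-! ### The residue field of the coarsening -/

section ResidueSide

variable {K F : Type u} [Field K] [Field F] [Algebra K F]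

/-- The two renderings of `Kv ⊆ Fv` agree: `residueSubfield K O` (`ValuationDefect.lean`) is
`resField O K'` (`ValuedFunctionFields.lean`) for the image `K' ⊆ F` of `K`. [folklore] -/
theorem residueSubfield_eq_resField (O : ValuationSubring F) :
    residueSubfield K O = resField O (algebraMap K F).fieldRange := by
  ext r
  rw [mem_residueSubfield_iff, mem_resField_iff]
  constructor
  · rintro ⟨c, h, rfl⟩
    exact ⟨⟨algebraMap K F c, h⟩, ⟨c, rfl⟩, rfl⟩
  · rintro ⟨a, ⟨c, hc⟩, rfl⟩
    have h : algebraMap K F c ∈ O := by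
      rw [hc]
      exact a.2
    refine ⟨c, h, ?_⟩
    congr 1
    exact Subtype.ext hc

/-- `Kv` is algebraically closed if `K` is (Kuhlmann 2010, Lemma 2.1: "the residue field of
`K̃` is algebraically closed"). PROVED (`isAlgClosed_resField_of_isAlgClosed`). [folklore] -/
theorem isAlgClosed_residueSubfield [IsAlgClosed K] (O : ValuationSubring F) :
    IsAlgClosed (residueSubfield K O) := by
  haveI : IsAlgClosed (algebraMap K F).fieldRange :=
    IsAlgClosed.of_ringEquiv K _ (RingEquiv.ofBijective (algebraMap K F).rangeRestrictField
      (algebraMap K F).rangeRestrictField_bijective)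
  rw [residueSubfield_eq_resField]
  exact isAlgClosed_resField_of_isAlgClosed O _

/-- The residue field of a valuation ring of an algebraically closed field is algebraically
closed (Kuhlmann 2010, Lemma 2.1). [folklore] -/
theorem isAlgClosed_residueField_of_isAlgClosed [IsAlgClosed K] (P : ValuationSubring K) :
    IsAlgClosed (ResidueField P) := by
  haveI : IsAlgClosed (⊤ : Subfield K) := IsAlgClosed.of_ringEquiv K _ Subfield.topEquiv.symm
  have h1 : IsAlgClosed (resField P ⊤) := isAlgClosed_resField_of_isAlgClosed P ⊤
  have htop : resField P ⊤ = ⊤ := by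
    refine eq_top_iff.mpr fun r _ => ?_
    obtain ⟨a, rfl⟩ := residue_surjective r
    exact (mem_resField_iff P ⊤ _).mpr ⟨a, trivial, rfl⟩
  rw [htop] at h1
  exact IsAlgClosed.of_ringEquiv _ _ Subfield.topEquiv

/-- If `Fv = Kv` for an algebraically closed `K`, the residue field `Fv` is algebraically closed.
[folklore] -/
theorem isAlgClosed_residueField_of_residueSubfield_eq_top [IsAlgClosed K] (O : ValuationSubring F)
    (h : residueSubfield K O = ⊤) : IsAlgClosed (ResidueField O) := by
  have h1 := isAlgClosed_residueSubfield (K := K) O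
  rw [h] at h1
  exact IsAlgClosed.of_ringEquiv _ _ Subfield.topEquiv

variable (O O₁ : ValuationSubring F) (hle : O ≤ O₁)

/-- **Kuhlmann 2010, Lemma 2.5, residue field of the Gauss valuation: `K(t₁)w = Kw(t̄₁)`** for a
generator `t₁` of `w`-value `0` with `w`-residue `t̄₁` transcendental over `Kw`. PROVED from
`residue_mem_closure_of_mem_closure` (`ValuationIndependence.lean`). [cite: Kuhlmann2010, Lemma 2.5] -/
theorem closure_residueSubfield_union_eq_top {t₁ : F} (ht₁ : t₁ ∈ O₁)
    (htr : Transcendental (residueSubfield K O₁) (residue O₁ ⟨t₁, ht₁⟩))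
    (hgen₁ : IntermediateField.adjoin K ({t₁} : Set F) = ⊤) :
    Subfield.closure ((residueSubfield K O₁ : Set (ResidueField O₁)) ∪ {residue O₁ ⟨t₁, ht₁⟩}) = ⊤ := by
  classical
  refine eq_top_iff.mpr fun r _ => ?_
  obtain ⟨y, rfl⟩ := residue_surjective r
  have hx0 : ∀ i : Fin 0, (Fin.elim0 : Fin 0 → F) i ≠ 0 := fun i => i.elim0
  have hxi : ∀ m : Fin 0 → ℤ, (∃ b ∈ (algebraMap K F).fieldRange,
      (∏ i, O₁.valuation ((Fin.elim0 : Fin 0 → F) i) ^ m i) = O₁.valuation b) → m = 0 :=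
    fun m _ => funext fun i => i.elim0
  have hy : ∀ j : Fin 1, (fun _ : Fin 1 => t₁) j ∈ O₁ := fun _ => ht₁
  have hri : AlgebraicIndependent (resField O₁ (algebraMap K F).fieldRange)
      (fun j : Fin 1 => residue O₁ ⟨(fun _ : Fin 1 => t₁) j, hy j⟩) := by
    rw [← residueSubfield_eq_resField]
    exact algebraicIndependent_unique_type_iff.mpr htr
  have hyF : (y : F) ∈ Subfield.closure (((algebraMap K F).fieldRange : Set F) ∪
      (Set.range (Fin.elim0 : Fin 0 → F) ∪ Set.range (fun _ : Fin 1 => t₁))) := by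
    have := mem_closure_of_adjoin_eq_top hgen₁ (y : F)
    rwa [Set.union_comm (Set.range fun _ : Fin 1 => t₁)] at this
  have hmem := residue_mem_closure_of_mem_closure O₁ (algebraMap K F).fieldRange hx0 hxi hy hri
    hyF y.2
  rw [← residueSubfield_eq_resField] at hmem
  have hmem' : residue O₁ ⟨(y : F), y.2⟩ ∈ Subfield.closure ((residueSubfield K O₁ : Set (ResidueField O₁)) ∪
      Set.range (fun _ : Fin 1 => residue O₁ ⟨t₁, ht₁⟩)) := hmem
  rwa [Set.range_const] at hmem'

/-- The restriction of `w̄ = v / w` to `Kw` is the residue valuation ring of `K° ⊆ (K ∩ F_w°)`: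
composite valuations restrict componentwise. [folklore] -/
theorem comap_residueFieldHom_residueValuationSubring :
    (residueValuationSubring O O₁ hle).comap (residueFieldHom K O₁) =
      residueValuationSubring (O.comap (algebraMap K F)) (O₁.comap (algebraMap K F))
        (fun _ hc => hle hc) := by
  ext c
  obtain ⟨x, rfl⟩ := residue_surjective c
  rw [ValuationSubring.mem_comap, residueFieldHom_residue, residue_mem_residueValuationSubring_iff,
    residue_mem_residueValuationSubring_iff, coe_comapSubringHom_apply]
  rfl

/-- **`t̄₁` is value-transcendental for `w̄` over `Kw`**: if `t₁` (of `w`-value `0`) is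
value-transcendental for `v = w ∘ w̄` over `K`, then `n·w̄(t̄₁) ∉ w̄(Kw)` for `n ≥ 1` (the
`w̄`-value of a `w`-residue `x̄` is the `v`-value of `x`). [cite: Kuhlmann2010, Lemma 2.8] -/
theorem valueTranscendental_residue {t₁ : F} (ht₁ : t₁ ∈ O₁) (hw : O₁.valuation t₁ = 1)
    (hvt₁ : ∀ n : ℕ, 0 < n → ∀ c : K, O.valuation t₁ ^ n ≠ O.valuation (algebraMap K F c)) :
    ∀ n : ℕ, 0 < n → ∀ c : ResidueField (O₁.comap (algebraMap K F)),
      (residueValuationSubring O O₁ hle).valuation (residue O₁ ⟨t₁, ht₁⟩) ^ n ≠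
        (residueValuationSubring O O₁ hle).valuation (residueFieldHom K O₁ c) := by
  intro n hn c h
  obtain ⟨x, rfl⟩ := residue_surjective c
  rw [residueFieldHom_residue] at h
  set Ob := residueValuationSubring O O₁ hle with hOb
  have ht₁0 : t₁ ≠ 0 := fun h0 => by
    rw [h0, map_zero] at hw
    exact zero_ne_one hw
  have hTn : t₁ ^ n ∈ O₁ := pow_mem ht₁ n
  have hwTn : O₁.valuation (t₁ ^ n) = 1 := by rw [map_pow, hw, one_pow]
  have hT : residue O₁ ⟨t₁, ht₁⟩ ^ n = residue O₁ ⟨t₁ ^ n, hTn⟩ := by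
    rw [← map_pow]
    rfl
  rw [← map_pow, hT] at h
  have hxO₁ : algebraMap K F x ∈ O₁ := x.2
  have hC : (comapSubringHom K O₁ x : O₁) = ⟨algebraMap K F x, hxO₁⟩ := Subtype.ext rfl
  rw [hC] at h
  -- the residue of `t₁ⁿ` is non-zero, so the residue of `x` is non-zero: `w(x) = 0`
  have hresT : residue O₁ ⟨t₁ ^ n, hTn⟩ ≠ 0 := fun h0 =>
    ((IsLocalRing.mem_maximalIdeal _).mp ((residue_eq_zero_iff _).mp h0))
      ((O₁.valuation_eq_one_iff _).mpr hwTn)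
  have hresx : residue O₁ ⟨algebraMap K F x, hxO₁⟩ ≠ 0 := by
    intro h0
    rw [h0, map_zero, map_eq_zero] at h
    exact hresT h
  have hwx : O₁.valuation (algebraMap K F x) = 1 := by
    refine (O₁.valuation_eq_one_iff ⟨_, hxO₁⟩).mp ?_
    by_contra hnu
    exact hresx ((residue_eq_zero_iff _).mpr ((IsLocalRing.mem_maximalIdeal _).mpr hnu))
  -- `r₁ / r₂` and `r₂ / r₁` lie in the valuation ring of `w̄`
  have hq : residue O₁ ⟨t₁ ^ n, hTn⟩ / residue O₁ ⟨algebraMap K F x, hxO₁⟩ ∈ Ob := by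
    refine (Ob.valuation_le_one_iff _).mp ?_
    rw [map_div₀, h, div_self ((map_ne_zero _).mpr hresx)]
  have hq' : residue O₁ ⟨algebraMap K F x, hxO₁⟩ / residue O₁ ⟨t₁ ^ n, hTn⟩ ∈ Ob := by
    refine (Ob.valuation_le_one_iff _).mp ?_
    rw [map_div₀, h, div_self ((map_ne_zero _).mpr hresx)]
  -- hence `t₁ⁿ / x` and `x / t₁ⁿ` lie in `O`: `v(t₁)ⁿ = v(x)`
  have hm1 : t₁ ^ n / algebraMap K F x ∈ O₁ := by
    rw [← O₁.valuation_le_one_iff, map_div₀, hwTn, hwx, div_one]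
  have hm2 : algebraMap K F x / t₁ ^ n ∈ O₁ := by
    rw [← O₁.valuation_le_one_iff, map_div₀, hwTn, hwx, div_one]
  rw [← residue_mk_div O₁ hTn hxO₁ hwx hm1, hOb, residue_mem_residueValuationSubring_iff] at hq
  rw [← residue_mk_div O₁ hxO₁ hTn hwTn hm2, hOb, residue_mem_residueValuationSubring_iff] at hq'
  change t₁ ^ n / algebraMap K F x ∈ O at hq
  change algebraMap K F x / t₁ ^ n ∈ O at hq'
  rw [← O.valuation_le_one_iff, map_div₀] at hq hq'
  have hvx : 0 < O.valuation (algebraMap K F x) := by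
    rw [zero_lt_iff, map_ne_zero]
    intro h0
    rw [h0, map_zero] at hwx
    exact zero_ne_one hwx
  have hvT : 0 < O.valuation (t₁ ^ n) := by
    rw [zero_lt_iff, map_ne_zero]
    exact pow_ne_zero _ ht₁0
  rw [div_le_one₀ hvx] at hq
  rw [div_le_one₀ hvT] at hq'
  apply hvt₁ n hn x
  rw [← map_pow]
  exact le_antisymm hq hq'

end ResidueSide

/-! ### Algebraically closed valued fields are defectless -/

section AlgClosed

/-- **An algebraically closed valued field is a defectless field**: its only finite extension is
itself, with `e = f = 1` (Kuhlmann 2010, §1: equality in the fundamental inequality).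
[folklore] -/
theorem isDefectlessField_of_isAlgClosed (L₀ : Type u) [Field L₀] [IsAlgClosed L₀]
    (O₀ : ValuationSubring L₀) : IsDefectlessField L₀ O₀ := by
  classical
  intro L _ _ hfin
  haveI := hfin
  haveI : Algebra.IsIntegral L₀ L := Algebra.IsIntegral.of_finite L₀ L
  have hbij := IsAlgClosed.algebraMap_bijective_of_isIntegral (k := L₀) (K := L)
  let e : L₀ ≃+* L := RingEquiv.ofBijective (algebraMap L₀ L) hbij
  -- `[L : L₀] = 1`
  have hrank : Module.finrank L₀ L = 1 := by
    rw [← (LinearEquiv.ofBijective (Algebra.linearMap L₀ L) hbij).finrank_eq, Module.finrank_self]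
  -- the unique extension of `O₀` to `L`
  refine ⟨{O₀.comap e.symm.toRingHom}, fun O' => ?_, ?_⟩
  · rw [Finset.mem_singleton]
    constructor
    · rintro rfl
      ext x
      change e.symm (algebraMap L₀ L x) ∈ O₀ ↔ x ∈ O₀
      rw [show algebraMap L₀ L x = e x from rfl, e.symm_apply_apply]
    · intro h
      ext y
      rw [← h]
      change y ∈ O' ↔ algebraMap L₀ L (e.symm y) ∈ O'
      rw [show algebraMap L₀ L (e.symm y) = e (e.symm y) from rfl, e.apply_symm_apply]
  · rw [Finset.sum_singleton, hrank]
    obtain ⟨h1, h2⟩ := one_le_ramificationIndex_and_inertiaDegree L₀ (O₀.comap e.symm.toRingHom)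
    have h3 := (ramificationIndex_mul_inertiaDegree_le_finrank L₀ (O₀.comap e.symm.toRingHom)).2.2
    rw [hrank] at h3
    exact le_antisymm h3 (Nat.one_le_iff_ne_zero.mpr (Nat.mul_ne_zero (by omega) (by omega)))

end AlgClosed

end Literature.AlgebraicGeometry.Resolution
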